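import Summits.MatrixMultiplication.MatrixMultiplication.Theorems.FarEdgeDescentExactDictionary
import HarnessLib

/-!
# Far-edge descent, kernel XXXVIII-C: the dictionary of the ANCHOR-BUDGET DIAL and the inert endpoint `β = 1`

Route `FarEdgeDescent`, special leaf `FiniteSaturation` (stmt-MatrixMultiplication-23739): helper
kernel, THESES-FREE and def-free (decomp-mm lens 2 «structural dichotomy: special vs generic», gen 58).

THE DICTIONARY.  Two anchored objects `⟨1,Q,1⟩ ⊕ legs`, `⟨1,Q',1⟩ ⊕ legs'` of a toolbox with ANCHOR
BUDGET FACTOR `β ≥ 1` have budgets `r = Q + βL`, `r' = Q' + βL'` (`L = ΣaB` over the legs).  Their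
product, fully re-anchored, keeps the legs `L'' = QL' + Q'L + LL'` and turns the rest of the budget into
anchor: `rr' = Q'' + βL''`, `Q'' = QQ' + β(β−1)LL'` (`dial_product_step` (i)); hence the share dynamics
`λ'' = λ + λ' − (2β−1)λλ'` (ii) — fixed point `1/(2β−1)` — `ℓ'' = ℓ + ℓ'` (iii), and by subadditivity of
`x ↦ x^t` on the new anchor the EXACT STEP INEQUALITY (iv)–(vi)

  `0 ≤ F'' ≤ F·F' + β(β−1)λλ'·min(1, exp(−(1−t)(ℓ'' − Λ)))`   (`rr' ≤ e^Λ·β(β−1)LL'`, `β(β−1)LL' ≥ 1`),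

with `F ≡ 1 − (β−1)λ` at `s = t = 1` (`dial_corner`).  `β = 2` is kernel XXXVII-C `exact_product_step`
(Knuth 4.6.4 Ex. 67(g): both variable sets of a kept leg are cut from the anchor; Alman–Li 2026 Thm. 5.1,
Prop. 5.3); for `1 < β < 2` no tensor mechanism is known (memo NODE-g53 §3(e): every asymmetric variant
is dominated) — the dial is the abstract recursion «what if anchors were cheaper».  `dial_coordinates`
is the change of variables `u = (2β−1)λ/3`, `a = 3(β−1)/(2β−1)` that turns these clauses into the
`a`-dial clauses of kernels XXXVIII-A/B (`u'' = u+u'−3uu'`, `1 − (β−1)λ = 1 − au`,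
`β(β−1)λλ' = a(3−a)uu'`, `λ ≤ 1/(2β−1) ⟺ u ≤ 1/3`), where `dial_ceiling` caps every `β ∈ (1,2]` at the
power order `θ_a < ∞`.

THE INERT ENDPOINT `β = 1` (`a = 0`, immortal anchors: `r = Q + L`, the direct-sum value itself).  Then
`Q'' = QQ'` — re-anchoring is free of charge but also free of gain — and the exact step is EXACTLY
MULTIPLICATIVE, `F'' = F·F'` (`inert_product_step`): no cross term at any `(s,t)`.  Consequently every
schedule is inert (`inert_schedule_blind`): if the bases pass (`F_B ≤ 1`, no margin, no wedge) then every
node of every DAG passes — the exclusion set of any tower is contained in the union of the exclusion sets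
of its bases, so towers certify nothing their bases do not.  This is the special side of the dichotomy in
its sharpest form: at the only budget factor of `FiniteSaturation` grade (`κ = 1` needs `β = 1`,
XXXVIII-B `dialKappa_pos_lt_one` + XXX `finiteSaturation_iff_linearWedge`) amplification is void, and the
leaf is a ONE-SHOT BASE-DESIGN problem (a single tensor identity), outside the blind class F19.1(b).

References: Schönhage 1981, §5; Pan 1984 (LNCS 179) §16 Props. 16.2–16.5; Knuth TAOCP 2 §4.6.4
Ex. 67(g),(h); Alman–Li 2026, Thm. 5.1, Prop. 5.3; Coppersmith–Winograd 1982.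
Tags: `FiniteSaturation` (h₁) NEC · WEAKER · ATTACKED; dictionary for the dial ceiling (XXXVIII-B).
-/

set_option linter.dupNamespace false

noncomputable section

namespace Summit.MatrixMultiplication.MatrixMultiplication.Theorems.FarEdgeDescentDialDictionary

open Summit.MatrixMultiplication.MatrixMultiplication.Theorems.FarEdgeDescentAnchorTax
open Summit.MatrixMultiplication.MatrixMultiplication.Theorems.FarEdgeDescentExactSteps
open Summit.MatrixMultiplication.MatrixMultiplication.Theorems.FarEdgeDescentExactDictionary

/-! ## §1 The exact product step with anchor budget factor `β` -/

/-- **THE DIAL PRODUCT STEP** (budget factor `β ≥ 1`; `β = 2` is XXXVII-C `exact_product_step`).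
Anchored objects with budgets `r = Q + βL`, `r' = Q' + βL'` (`Q, Q' ≥ 1`, `L, L' ≥ 0`,
`β(β−1)LL' ≥ 1`), full virtual sums `V = Q^t + G`, `V' = Q'^t + G'` (`0 ≤ t ≤ 1`, `G, G' ≥ 0`).  The
re-anchored product has (i) `rr' = (QQ' + β(β−1)LL') + β(QL' + Q'L + LL')`, (ii) share
`λ'' = λ + λ' − (2β−1)λλ'`, (iii) `ℓ'' = ℓ + ℓ'`, and full virtual sum `V'' = Q''^t + (VV' − (QQ')^t)` with
(iv) `0 ≤ V''/(rr')`, (v) `V''/(rr') ≤ FF' + β(β−1)λλ'`, (vi) `V''/(rr') ≤ FF' + β(β−1)λλ'·exp(−(1−t)(ℓ''−Λ))`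
whenever `rr' ≤ e^Λ·β(β−1)LL'`: subadditivity `(QQ' + x)^t ≤ (QQ')^t + x^t` and `x^t = x·x^{−(1−t)}`,
`x = β(β−1)LL'`. [cite: Schonhage1981, §5] [cite: Pan1984, Props. 16.2–16.5] [cite: AlmanLi2026, Thm. 5.1]
[cite: KnuthTAOCP2, §4.6.4 Ex. 67] -/
theorem dial_product_step {β Q L Q' L' G G' t Λ : ℝ} (hβ : 1 ≤ β) (hQ : 1 ≤ Q) (hQ' : 1 ≤ Q')
    (hL : 0 ≤ L) (hL' : 0 ≤ L') (hx : 1 ≤ β * (β - 1) * L * L') (hG : 0 ≤ G) (hG' : 0 ≤ G')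
    (ht0 : 0 ≤ t) (ht1 : t ≤ 1)
    (hΛ : (Q + β * L) * (Q' + β * L') ≤ Real.exp Λ * (β * (β - 1) * L * L')) :
    (Q + β * L) * (Q' + β * L') =
        (Q * Q' + β * (β - 1) * L * L') + β * (Q * L' + Q' * L + L * L') ∧
      (Q * L' + Q' * L + L * L') / ((Q + β * L) * (Q' + β * L')) =
        L / (Q + β * L) + L' / (Q' + β * L') -
          (2 * β - 1) * (L / (Q + β * L)) * (L' / (Q' + β * L')) ∧
      Real.log ((Q + β * L) * (Q' + β * L')) = Real.log (Q + β * L) + Real.log (Q' + β * L') ∧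
      0 ≤ ((Q * Q' + β * (β - 1) * L * L') ^ t + ((Q ^ t + G) * (Q' ^ t + G') - (Q * Q') ^ t)) /
          ((Q + β * L) * (Q' + β * L')) ∧
      ((Q * Q' + β * (β - 1) * L * L') ^ t + ((Q ^ t + G) * (Q' ^ t + G') - (Q * Q') ^ t)) /
          ((Q + β * L) * (Q' + β * L')) ≤
        (Q ^ t + G) / (Q + β * L) * ((Q' ^ t + G') / (Q' + β * L')) +
          β * (β - 1) * (L / (Q + β * L)) * (L' / (Q' + β * L')) ∧
      ((Q * Q' + β * (β - 1) * L * L') ^ t + ((Q ^ t + G) * (Q' ^ t + G') - (Q * Q') ^ t)) /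
          ((Q + β * L) * (Q' + β * L')) ≤
        (Q ^ t + G) / (Q + β * L) * ((Q' ^ t + G') / (Q' + β * L')) +
          β * (β - 1) * (L / (Q + β * L)) * (L' / (Q' + β * L')) *
            Real.exp (-((1 - t) * (Real.log ((Q + β * L) * (Q' + β * L')) - Λ))) := by
  have hβL : 0 ≤ β * L := mul_nonneg (by linarith) hL
  have hβL' : 0 ≤ β * L' := mul_nonneg (by linarith) hL'
  have hr : 0 < Q + β * L := by linarith
  have hr' : 0 < Q' + β * L' := by linarith
  have hrr : 0 < (Q + β * L) * (Q' + β * L') := mul_pos hr hr'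
  have hx0 : 0 < β * (β - 1) * L * L' := by linarith
  have hsub : (Q * Q' + β * (β - 1) * L * L') ^ t ≤ (Q * Q') ^ t + (β * (β - 1) * L * L') ^ t :=
    Real.rpow_add_le_add_rpow (by positivity) hx0.le ht0 ht1
  have hE1 : (β * (β - 1) * L * L') ^ t ≤ β * (β - 1) * L * L' :=
    (Real.rpow_le_rpow_of_exponent_le hx ht1).trans_eq (Real.rpow_one _)
  have hE2 : (β * (β - 1) * L * L') ^ t ≤ β * (β - 1) * L * L' *
      Real.exp (-((1 - t) * (Real.log ((Q + β * L) * (Q' + β * L')) - Λ))) := by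
    rw [rpow_eq_mul_exp hx0]
    apply mul_le_mul_of_nonneg_left _ hx0.le
    apply Real.exp_le_exp.2
    have hlog : Real.log ((Q + β * L) * (Q' + β * L')) - Λ ≤ Real.log (β * (β - 1) * L * L') := by
      have h := Real.log_le_log hrr hΛ
      rw [Real.log_mul (Real.exp_pos Λ).ne' hx0.ne', Real.log_exp] at h
      linarith
    have := mul_le_mul_of_nonneg_left hlog (by linarith : (0 : ℝ) ≤ 1 - t)
    linarith
  have hV : 0 ≤ (Q ^ t + G) * (Q' ^ t + G') - (Q * Q') ^ t := by
    rw [Real.mul_rpow (by linarith) (by linarith)]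
    have hQt : 0 ≤ Q ^ t := Real.rpow_nonneg (by linarith) t
    have hQt' : 0 ≤ Q' ^ t := Real.rpow_nonneg (by linarith) t
    nlinarith [mul_nonneg hQt hG', mul_nonneg hG hQt', mul_nonneg hG hG']
  refine ⟨by ring, ?_, Real.log_mul hr.ne' hr'.ne', ?_, ?_, ?_⟩
  · field_simp
    ring
  · exact div_nonneg (add_nonneg (Real.rpow_nonneg (by positivity) t) hV) hrr.le
  · rw [div_le_iff₀ hrr]
    have e : ((Q ^ t + G) / (Q + β * L) * ((Q' ^ t + G') / (Q' + β * L')) +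
        β * (β - 1) * (L / (Q + β * L)) * (L' / (Q' + β * L'))) * ((Q + β * L) * (Q' + β * L')) =
        (Q ^ t + G) * (Q' ^ t + G') + β * (β - 1) * L * L' := by
      field_simp
    rw [e]
    linarith [hsub, hE1]
  · rw [div_le_iff₀ hrr]
    have e : ((Q ^ t + G) / (Q + β * L) * ((Q' ^ t + G') / (Q' + β * L')) +
        β * (β - 1) * (L / (Q + β * L)) * (L' / (Q' + β * L')) *
          Real.exp (-((1 - t) * (Real.log ((Q + β * L) * (Q' + β * L')) - Λ)))) *
          ((Q + β * L) * (Q' + β * L')) =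
        (Q ^ t + G) * (Q' ^ t + G') + β * (β - 1) * L * L' *
          Real.exp (-((1 - t) * (Real.log ((Q + β * L) * (Q' + β * L')) - Λ))) := by
      field_simp
    rw [e]
    linarith [hsub, hE2]

/-- **The corner value on the dial.**  At `s = t = 1` an anchored object with budget `r = Q + βL` has
normalised value `(Q + L)/r = 1 − (β−1)λ`, `λ = L/r`: the base margin of the `β`-toolbox is `(β−1)λ`
(`β = 2`: `1 − λ`, kernel XXXVII; `β = 1`: NO margin — the direct-sum value is the budget). [folklore] -/
theorem dial_corner {β Q L : ℝ} (hr : Q + β * L ≠ 0) :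
    (Q + L) / (Q + β * L) = 1 - (β - 1) * (L / (Q + β * L)) := by
  rw [eq_sub_iff_add_eq, mul_div_assoc', ← add_div, div_eq_one_iff_eq hr]
  ring

/-- **Base census on the dial.**  If the anchor satisfies `Q^t ≤ Q` and the legs' virtual value satisfies
`G ≤ L(1 + Dσ)` (`block_value_le`: `a^sB^t ≤ aB(1 + (a−1)(s−1))`), then the base readout obeys
`(Q^t + G)/r ≤ 1 − (β−1)λ + Dσ·λ`, `λ = L/r`, `r = Q + βL > 0`: the base excess over the corner value is
linear in `σ = s − 1` and proportional to the share. [cite: Schonhage1981, §5] -/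
theorem dial_base_census {β Q L G D σ t : ℝ} (hr : 0 < Q + β * L) (hQt : Q ^ t ≤ Q)
    (hG : G ≤ L * (1 + D * σ)) :
    (Q ^ t + G) / (Q + β * L) ≤ 1 - (β - 1) * (L / (Q + β * L)) + D * σ * (L / (Q + β * L)) := by
  rw [div_le_iff₀ hr]
  have e : (1 - (β - 1) * (L / (Q + β * L)) + D * σ * (L / (Q + β * L))) * (Q + β * L) =
      Q + L + D * σ * L := by
    field_simp
    ring
  rw [e]
  linarith

/-- **Change of variables `(β, λ) ↦ (a, u)`.**  With `u = (2β−1)λ/3`, `u' = (2β−1)λ'/3` and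
`a = 3(β−1)/(2β−1)` (`β > 1/2`): (a) the share dynamics becomes `β`-free,
`(2β−1)(λ + λ' − (2β−1)λλ')/3 = u + u' − 3uu'`; (b) the base margin `(β−1)λ = a·u`; (c) the cross
coefficient `β(β−1)λλ' = a(3−a)uu'`; (d) the fixed-point window `λ ≤ 1/(2β−1) ⟺ u ≤ 1/3`.  So the clauses
of `dial_product_step` are literally the `a`-dial clauses of XXXVIII-B `dial_ceiling`
(`F'' ≤ FF' + a(3−a)uu'·min(1, e^{−τ(ℓ''−Λ)})`, base `F ≤ 1 − au + …`), with `a ∈ (0,1]` for `β ∈ (1,2]`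
(XXXVIII-0 `dial_of_budget`). [folklore] -/
theorem dial_coordinates {β lam lam' : ℝ} (hβ : 1 / 2 < β) :
    (2 * β - 1) / 3 * (lam + lam' - (2 * β - 1) * lam * lam') =
        (2 * β - 1) / 3 * lam + (2 * β - 1) / 3 * lam' -
          3 * ((2 * β - 1) / 3 * lam) * ((2 * β - 1) / 3 * lam') ∧
      (β - 1) * lam = 3 * (β - 1) / (2 * β - 1) * ((2 * β - 1) / 3 * lam) ∧
      β * (β - 1) * lam * lam' =
        3 * (β - 1) / (2 * β - 1) * (3 - 3 * (β - 1) / (2 * β - 1)) *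
          ((2 * β - 1) / 3 * lam) * ((2 * β - 1) / 3 * lam') ∧
      (lam ≤ 1 / (2 * β - 1) ↔ (2 * β - 1) / 3 * lam ≤ 1 / 3) := by
  have h : 0 < 2 * β - 1 := by linarith
  have hne : 2 * β - 1 ≠ 0 := h.ne'
  have e : 3 - 3 * (β - 1) / (2 * β - 1) = 3 * β / (2 * β - 1) := by
    rw [eq_div_iff hne, sub_mul, div_mul_cancel₀ _ hne]
    ring
  refine ⟨by ring, ?_, ?_, ?_⟩
  · rw [div_mul_eq_mul_div, eq_div_iff hne]
    ring
  · rw [e, div_mul_div_comm, div_mul_eq_mul_div, div_mul_eq_mul_div, eq_div_iff (mul_ne_zero hne hne)]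
    ring
  · rw [le_div_iff₀ h, div_mul_eq_mul_div, div_le_iff₀ (by norm_num : (0 : ℝ) < 3)]
    constructor
    · intro h1; linarith
    · intro h1; linarith

/-! ## §2 The inert endpoint `β = 1`: immortal anchors, multiplicative steps, inert towers -/

/-- **THE INERT PRODUCT STEP (`β = 1`).**  With immortal anchors (`r = Q + L`, the direct-sum value) the
re-anchored product has `Q'' = QQ'` — NO free lunch (`(Q+L)(Q'+L') = QQ' + (QL' + Q'L + LL')`) — and its
exact readout is EXACTLY MULTIPLICATIVE at every `(s,t)`:
`V''/(rr') = ((QQ')^t + (VV' − (QQ')^t))/(rr') = (V/r)·(V'/r')`, i.e. `F'' = F·F'` with no cross term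
(contrast `β > 1`: `+ β(β−1)λλ'·x^{−τ}`, the source of all deep certifying power, XXXVII-A `deep_step`).
[cite: Schonhage1981, §5] [cite: KnuthTAOCP2, §4.6.4 Ex. 67] -/
theorem inert_product_step (Q L Q' L' V V' t : ℝ) :
    (Q + L) * (Q' + L') = Q * Q' + (Q * L' + Q' * L + L * L') ∧
      ((Q * Q') ^ t + (V * V' - (Q * Q') ^ t)) / ((Q + L) * (Q' + L')) =
        V / (Q + L) * (V' / (Q' + L')) := by
  refine ⟨by ring, ?_⟩
  rw [add_sub_cancel, div_mul_div_comm]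

/-- **INERT TOWERS (`β = 1`): every schedule certifies exactly what its bases certify.**  In a
product-and-reanchor DAG whose product nodes obey the multiplicative step `0 ≤ F_j ≤ F_mF_n`
(`inert_product_step`) and whose bases merely PASS (`0 ≤ F_B ≤ 1` — no margin, no restriction on
`(s,t)`), EVERY node passes: `F_j ≤ 1`.  Contrapositively the exclusion set `{F_j > 1}` of any tower lies
in the union of its bases' exclusion sets: at the special endpoint amplification is void, and a
`FiniteSaturation`-grade certificate, if the `β = 1` toolbox has one, is a SINGLE base identity
(contrast `β = 2`: bases must pass with margin `λ_B/3` for base-fed blindness, XXXVII-C `baseFed_blind`,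
and deep × deep products do certify power rates, XXXI). [cite: Schonhage1981, §5]
[cite: CoppersmithWinograd1982] -/
theorem inert_schedule_blind (F : ℕ → ℝ)
    (H : ∀ j, (0 ≤ F j ∧ F j ≤ 1) ∨ (∃ m, m < j ∧ ∃ n, n < j ∧ 0 ≤ F j ∧ F j ≤ F m * F n)) :
    ∀ j, 0 ≤ F j ∧ F j ≤ 1 := by
  intro j
  induction j using Nat.strong_induction_on with
  | _ j ih => ?_
  rcases H j with ⟨h0, h1⟩ | ⟨m, hm, n, hn, h0, h1⟩
  · exact ⟨h0, h1⟩
  · obtain ⟨hm0, hm1⟩ := ih m hm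
    obtain ⟨hn0, hn1⟩ := ih n hn
    exact ⟨h0, le_trans h1 (by nlinarith [mul_le_mul hm1 hn1 hn0 zero_le_one])⟩

/-- **INERT TOWERS, FAILURE SIDE (`β = 1`): failing is hereditary and towers only deepen it.**  If the
product nodes obey `F_mF_n ≤ F_j` (the other half of `F'' = FF'`) and every base FAILS at the given
`(s,t)` (`1 ≤ F_B`), then every node fails, `1 ≤ F_j`: the exclusion set of a tower CONTAINS the
intersection of its bases' exclusion sets and (by `inert_schedule_blind`) is contained in their union —
for a one-base family the tower's pass set IS the base's pass set at every `(s,t)`. [folklore] -/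
theorem inert_schedule_fail (F : ℕ → ℝ)
    (H : ∀ j, 1 ≤ F j ∨ (∃ m, m < j ∧ ∃ n, n < j ∧ F m * F n ≤ F j)) :
    ∀ j, 1 ≤ F j := by
  intro j
  induction j using Nat.strong_induction_on with
  | _ j ih => ?_
  rcases H j with h1 | ⟨m, hm, n, hn, h1⟩
  · exact h1
  · have hm1 := ih m hm
    have hn1 := ih n hn
    nlinarith [mul_le_mul hm1 hn1 zero_le_one (le_trans zero_le_one hm1)]

end Summit.MatrixMultiplication.MatrixMultiplication.Theorems.FarEdgeDescentDialDictionary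

end
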